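import Literature.NumberTheory.Automorphic.CuspidalCohomologyGL
import Literature.Algebra.Homology.GroupCohomologySemilinearBijective
import HarnessLib

/-!
# Restriction of scalars for the twisted quotient cohomology `H^q(S_L, Ṽ)`

Topic `NumberTheory/Automorphic`; namespace `Literature.NumberTheory.Automorphic.TwistedQuotient`.
Definitions with bodies and theorems; no named fact, no instance, no `sorry`.

For an `R`-algebra `k` and a `k`-linear representation `ρ` of `Γ` on `V`, the same additive
`Γ`-module `Fun(𝒢 ⧸ L, V)_ρ` may be regarded over `R` (`resScalars R ρ`).  The standard complex only
sees the additive structure [Brown1982CohomologyGroups, III.1 Ex. 3], so: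

* `coeffIdSemimap` — the identity `Fun(𝒢/L, V)_{ρ|R} → Fun(𝒢/L, V)_ρ` as an
  `algebraMap R k`-semilinear `Γ`-equivariant bijection;
* **`cohomologyResScalars q : H^q_R(S_L, Ṽ) →ₛₗ H^q_k(S_L, Ṽ)`**, bijective
  (`cohomologyResScalars_bijective`, from `GroupCohomologySemilinearBijective`), and commuting with
  the Hecke operators `[L g L]` (`cohomologyResScalars_heckeEnd`).

Use: compare the `ℚ̄_p`-cohomology of the statement of [Scholze2015, Cor. V.4.2]-type results with
the `ℤ_p`-cohomology carrying the integral structures of the proof of [Scholze2015, Thm. V.4.1].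

## References

* K. S. Brown, *Cohomology of Groups*, GTM 87 (1982), III.1 Example 3. [Brown1982CohomologyGroups]
* P. Scholze, Ann. of Math. 182 (2015), §V.4. [Scholze2015]
-/

noncomputable section

open CategoryTheory Literature.Algebra.Homology

universe u

namespace Literature.NumberTheory.Automorphic

namespace TwistedQuotient

variable (R : Type u) {k : Type u} [CommRing R] [CommRing k] [Algebra R k] {Γ 𝒢 : Type u}
  [Group Γ] [Group 𝒢] (ι : Γ →* 𝒢) (L : Subgroup 𝒢) {V : Type u} [AddCommGroup V] [Module k V]
  [Module R V] [IsScalarTower R k V] (ρ : Representation k Γ V)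

/-- **Restriction of scalars of a representation** along `R → k`. [folklore] -/
def resScalars : Representation R Γ V where
  toFun γ := (ρ γ).restrictScalars R
  map_one' := LinearMap.ext fun v => by simp
  map_mul' γ γ' := LinearMap.ext fun v => by simp

/-- Unfolding lemma for `resScalars`. [folklore] -/
@[simp]
theorem resScalars_apply (γ : Γ) (v : V) : resScalars R ρ γ v = ρ γ v :=
  rfl

/-- **The identity of `Fun(𝒢 ⧸ L, V)` as a semilinear map** from the `R`-structure to the
`k`-structure. [folklore] -/
def coeffIdSemimap :
    (coeffRep ι L (resScalars R ρ)).V →ₛₗ[algebraMap R k] (coeffRep ι L ρ).V where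
  toFun f := f
  map_add' _ _ := rfl
  map_smul' r f := funext fun c => (algebraMap_smul k r (f c)).symm

/-- Unfolding lemma. [folklore] -/
@[simp]
theorem coeffIdSemimap_apply (f : (𝒢 ⧸ L) → V) : coeffIdSemimap R ι L ρ f = f :=
  rfl

/-- The identity is `Γ`-equivariant (both sides act by `(γ f)(c) = ρ(γ) f(ι(γ)⁻¹ c)`). [folklore] -/
theorem coeffIdSemimap_equivariant (γ : Γ) (f : (coeffRep ι L (resScalars R ρ)).V) :
    coeffIdSemimap R ι L ρ ((coeffRep ι L (resScalars R ρ)).ρ γ f) =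
      (coeffRep ι L ρ).ρ γ (coeffIdSemimap R ι L ρ f) :=
  rfl

/-- The identity is bijective. [folklore] -/
theorem coeffIdSemimap_bijective : Function.Bijective (coeffIdSemimap R ι L ρ) :=
  Function.bijective_id

/-- **`H^q_R(S_L, Ṽ) → H^q_k(S_L, Ṽ)`**, the comparison of the cohomology computed over `R` and
over `k` (a semilinear map). [cite: Brown1982CohomologyGroups, III.1 Example 3] -/
def cohomologyResScalars (q : ℕ) :
    cohomology ι L (resScalars R ρ) q →ₛₗ[algebraMap R k] cohomology ι L ρ q :=
  semimap (coeffIdSemimap R ι L ρ) (coeffIdSemimap_equivariant R ι L ρ) q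

/-- **The comparison is bijective.** [cite: Brown1982CohomologyGroups, III.1 Example 3] -/
theorem cohomologyResScalars_bijective (q : ℕ) :
    Function.Bijective (cohomologyResScalars R ι L ρ q) :=
  semimap_bijective_of_bijective _ _ (coeffIdSemimap_bijective R ι L ρ) q

omit [Algebra R k] [IsScalarTower R k V] in
/-- The Hecke operators on functions do not depend on the scalar ring. [folklore] -/
theorem heckeFun_resScalars (g : 𝒢) (f : (𝒢 ⧸ L) → V) :
    ArithmeticQuotient.heckeFun R L g V f = ArithmeticQuotient.heckeFun k L g V f :=
  rfl

/-- **The comparison commutes with the Hecke operators `[L g L]`.**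
[cite: Brown1982CohomologyGroups, III.1 Example 3] -/
theorem cohomologyResScalars_heckeEnd (g : 𝒢) (q : ℕ) (x : cohomology ι L (resScalars R ρ) q) :
    cohomologyResScalars R ι L ρ q (heckeEnd ι L (resScalars R ρ) g q x) =
      heckeEnd ι L ρ g q (cohomologyResScalars R ι L ρ q x) :=
  semimap_map_endo (coeffIdSemimap R ι L ρ) (coeffIdSemimap_equivariant R ι L ρ)
    (heckeRepHom ι L (resScalars R ρ) g) (heckeRepHom ι L ρ g) (fun _ => rfl) q x

/-- Iterated form: the comparison commutes with every polynomial expression built from Hecke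
operators, e.g. powers. [folklore] -/
theorem cohomologyResScalars_heckeEnd_pow (g : 𝒢) (q m : ℕ)
    (x : cohomology ι L (resScalars R ρ) q) :
    cohomologyResScalars R ι L ρ q ((heckeEnd ι L (resScalars R ρ) g q ^ m) x) =
      (heckeEnd ι L ρ g q ^ m) (cohomologyResScalars R ι L ρ q x) := by
  induction m generalizing x with
  | zero => simp
  | succ m ih => rw [pow_succ, pow_succ, Module.End.mul_apply, Module.End.mul_apply, ih,
      cohomologyResScalars_heckeEnd]

end TwistedQuotient

end Literature.NumberTheory.Automorphic
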